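import Literature.Topology.FourManifolds.GompfTheorem43
import Literature.AlgebraicTopology.FundamentalGroup.PosDetMatrixFundamentalGroup
import HarnessLib

/-!
# Discharge of the `π₁` leaves of Gompf's Theorem 4.3: `π₁(GL⁺(3, ℝ)) = ℤ/2` and the essential loop

`GompfTheorem43.lean` proves Gompf's Theorem 4.3 (R. Gompf, *More Cappell–Shaneson spheres are
standard*, Algebr. Geom. Topol. 10 (2010)) from atomic named facts, two of which are statements of
classical algebraic topology:

* **P1** `Literature.Topology.FourManifolds.fundamentalGroup_posDetMatrix_three` — `π₁(GL⁺(3, ℝ), 1)` has exactly two elements;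
* **P2** `Literature.Topology.FourManifolds.gompf2010_framingLoop_essential` — the loop `τ·ρ` through the five matrices
  `A, Δ²A, Δ²AΔ₀², A₀, B, A` of the proof of Thm 4.3 is not null-homotopic in `GL⁺(3, ℝ)` ("It now
  suffices to compute the mod `2` winding number of `(a, c)` in `ℝ²`, but this is nonzero by
  inspection").

Both are **proved** here (`Literature.Topology.FourManifolds.fundamentalGroup_posDetMatrix_three_holds`,
`Literature.Topology.FourManifolds.gompf2010_framingLoop_essential_holds`). P1 is `Literature.AlgebraicTopology.FundamentalGroup.GLPos3.card_fundamentalGroup`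
(`PosDetMatrixFundamentalGroup.lean`: Gram–Schmidt deformation retraction onto `SO(3)` and the
universal cover `S³ → SO(3)`). For P2 we follow the printed argument: along the loop every matrix
has first column `e₃`, so its Gram–Schmidt image in `SO(3)` is the frame
`G(p, r) = (e₃, (p, r, 0), e₃ × (p, r, 0))` with `(p, r)` the normalised first two entries `(a, c)`
of the second column (`Literature.Topology.FourManifolds.GS3.gs_eq_gompfGS`); `(a, c)` runs once around the square
`(-1,-1) → (1,-1) → (1,1) → (-1,1) → (-1,-1)`; we write down the lift of `G(p, r) = Rot_z(ψ) P₀` to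
the unit quaternions, `(cos(ψ/2) + sin(ψ/2) k) · p₀`, by the half-angle formulas on two overlapping
branches (`Literature.Topology.FourManifolds.liftF3`, `Literature.Topology.FourManifolds.liftF5`), check that it projects to the retracted loop segment by
segment, and observe that it ends at `-(start)`; by uniqueness of path lifting and the monodromy
theorem for the covering `S³ → SO(3)` (`RotationGroupSO3.lean`, Mathlib's
`IsCoveringMap.liftPath_apply_one_eq_of_homotopicRel`) the retracted loop, hence the loop, is
essential.

Consequently the assembly of `Literature.Topology.FourManifolds.nonempty_diffeomorph_sphere_four_of_isCappellShanesonSphereOf`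
needs only the six geometric leaves (`Literature.Topology.FourManifolds.nonempty_diffeomorph_sphere_four_of_isCappellShanesonSphereOf_of_geometric`).

## References

* R. E. Gompf, *More Cappell–Shaneson spheres are standard*, Algebr. Geom. Topol. 10 (2010)
  1665–1681: Thm 4.3, proof, last paragraph. [GompfAGT2010]
* A. Hatcher, *Algebraic Topology* (2002), §1.1 (path lifting, Prop. 1.30–1.31), §3.D. [HatcherAT2002]
-/

noncomputable section

open scoped Manifold ContDiff
open Set Function Matrix Topology unitInterval Quaternion

namespace Literature.Topology.FourManifolds

/-! ### P1 -/

/-- **P1 discharged: `π₁(GL⁺(3, ℝ), 1)` has exactly two elements** (`PosDetMatrix 3` is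
definitionally the subtype `{M // 0 < det M}` of `PosDetMatrixFundamentalGroup.lean`). [cite: HatcherAT2002, §3.D (GLₙ(ℝ) deformation retracts onto O(n); SO(3) ≈ ℝP³) and Example 1.43 (π₁(ℝP³) = ℤ₂)] -/
theorem fundamentalGroup_posDetMatrix_three_holds : fundamentalGroup_posDetMatrix_three :=
  Literature.AlgebraicTopology.FundamentalGroup.GLPos3.card_fundamentalGroup

/-! ### The frame `G(p, r)` and its quaternion lifts -/

section Frames

/-- **The frame `G(p, r) = (e₃ | (p, r, 0) | (-r, p, 0))`**: the Gram–Schmidt image of a matrix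
with first column `e₃` and second column `(a, c, e)`, `(p, r) = (a, c)/|(a, c)|` ("Each matrix in
`τ·ρ` has first column `[0 0 1]ᵀ`, which is unchanged by the Gram–Schmidt procedure. The second
column `[a c e]ᵀ` becomes `[a c 0]ᵀ` up to positive scale, and the third column can be ignored since
it is uniquely determined by the first two"). [cite: GompfAGT2010, Thm 4.3 (proof, last paragraph)] -/
def gompfGS (p r : ℝ) : Matrix (Fin 3) (Fin 3) ℝ := !![0, p, -r; 0, r, p; 1, 0, 0]

/-- **The third column is determined by the first two**: an element of `SO(3)` with first column
`e₃` and second column `(p, r, 0)` is `G(p, r)`, and `p² + r² = 1`. [cite: GompfAGT2010, Thm 4.3 (proof: the third column is uniquely determined by the first two)] -/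
theorem _root_.Literature.AlgebraicTopology.FundamentalGroup.SO3.eq_gompfGS (Q : Literature.AlgebraicTopology.FundamentalGroup.SO3) (h00 : Q.1 0 0 = 0) (h10 : Q.1 1 0 = 0) (h20 : Q.1 2 0 = 1)
    (h21 : Q.1 2 1 = 0) : Q.1 = gompfGS (Q.1 0 1) (Q.1 1 1) ∧ Q.1 0 1 ^ 2 + Q.1 1 1 ^ 2 = 1 := by
  -- third row is `e₁`: rows are orthonormal
  have r2 := Q.sum_mul_eq' 2 2
  simp only [if_true] at r2
  rw [h20, h21] at r2
  have h22 : Q.1 2 2 = 0 := by nlinarith [sq_nonneg (Q.1 2 2)]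
  have c11 := Q.sum_mul_eq 1 1
  have c22 := Q.sum_mul_eq 2 2
  have c12 := Q.sum_mul_eq 1 2
  simp only [if_true, Fin.isValue, show ((1 : Fin 3) = 2) = False by decide, if_false] at c11 c22 c12
  rw [h21] at c11 c12
  rw [h22] at c22 c12
  have hdet := Q.2.2
  rw [Matrix.det_fin_three, h00, h10, h20, h21, h22] at hdet
  have hpr : Q.1 0 1 ^ 2 + Q.1 1 1 ^ 2 = 1 := by nlinarith
  have hxy : Q.1 0 2 ^ 2 + Q.1 1 2 ^ 2 = 1 := by nlinarith
  have hsum : (Q.1 0 2 + Q.1 1 1) ^ 2 + (Q.1 1 2 - Q.1 0 1) ^ 2 = 0 := by nlinarith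
  have hx : Q.1 0 2 = -Q.1 1 1 := by
    nlinarith [sq_nonneg (Q.1 0 2 + Q.1 1 1), sq_nonneg (Q.1 1 2 - Q.1 0 1)]
  have hy : Q.1 1 2 = Q.1 0 1 := by
    nlinarith [sq_nonneg (Q.1 0 2 + Q.1 1 1), sq_nonneg (Q.1 1 2 - Q.1 0 1)]
  refine ⟨?_, hpr⟩
  ext i j
  fin_cases i <;> fin_cases j <;> simp [gompfGS, h00, h10, h20, h21, h22, hx, hy]

/-- **Gram–Schmidt of a matrix with first column `e₃`**: `gs M = G(a/n, c/n)` with `(a, c)` the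
first two entries of the second column and `n = |(a, c)| ≠ 0`. [cite: GompfAGT2010, Thm 4.3 (proof: the first column is unchanged, the second becomes (a, c, 0) up to positive scale)] -/
theorem GS3.gs_eq_gompfGS {M : Matrix (Fin 3) (Fin 3) ℝ} (hdet : 0 < M.det) (h00 : M 0 0 = 0)
    (h10 : M 1 0 = 0) (h20 : M 2 0 = 1) :
    Literature.AlgebraicTopology.FundamentalGroup.GS3.gs M = gompfGS (M 0 1 / Real.sqrt (M 0 1 ^ 2 + M 1 1 ^ 2))
      (M 1 1 / Real.sqrt (M 0 1 ^ 2 + M 1 1 ^ 2)) := by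
  have hA : Literature.AlgebraicTopology.FundamentalGroup.GS3.nA M = 1 := by
    simp [Literature.AlgebraicTopology.FundamentalGroup.GS3.nA, Literature.AlgebraicTopology.FundamentalGroup.GS3.col, dotProduct, Fin.sum_univ_three, h00, h10, h20]
  have hB : Literature.AlgebraicTopology.FundamentalGroup.GS3.cB M = M 2 1 := by
    simp [Literature.AlgebraicTopology.FundamentalGroup.GS3.cB, Literature.AlgebraicTopology.FundamentalGroup.GS3.u0, hA, Literature.AlgebraicTopology.FundamentalGroup.GS3.col, dotProduct, Fin.sum_univ_three, h00, h10, h20]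
  have hw1 : ∀ i, Literature.AlgebraicTopology.FundamentalGroup.GS3.w1 M i = ![M 0 1, M 1 1, 0] i := by
    intro i
    fin_cases i <;> simp [Literature.AlgebraicTopology.FundamentalGroup.GS3.w1, hB, Literature.AlgebraicTopology.FundamentalGroup.GS3.u0, hA, Literature.AlgebraicTopology.FundamentalGroup.GS3.col, h00, h10, h20]
  have hC : Literature.AlgebraicTopology.FundamentalGroup.GS3.nC M = Real.sqrt (M 0 1 ^ 2 + M 1 1 ^ 2) := by
    rw [Literature.AlgebraicTopology.FundamentalGroup.GS3.nC]
    congr 1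
    simp only [dotProduct, Fin.sum_univ_three, hw1]
    simp
    ring
  have hu1 : ∀ i, Literature.AlgebraicTopology.FundamentalGroup.GS3.u1 M i = ![M 0 1 / Real.sqrt (M 0 1 ^ 2 + M 1 1 ^ 2),
      M 1 1 / Real.sqrt (M 0 1 ^ 2 + M 1 1 ^ 2), 0] i := by
    intro i
    rw [Literature.AlgebraicTopology.FundamentalGroup.GS3.u1, Pi.smul_apply, hw1, hC, smul_eq_mul]
    fin_cases i <;> simp [div_eq_inv_mul]
  set Q : Literature.AlgebraicTopology.FundamentalGroup.SO3 := ⟨Literature.AlgebraicTopology.FundamentalGroup.GS3.gs M, Literature.AlgebraicTopology.FundamentalGroup.GS3.transpose_gs_mul_gs hdet.ne', Literature.AlgebraicTopology.FundamentalGroup.GS3.det_gs hdet⟩ with hQ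
  have e0 : ∀ i, Q.1 i 0 = Literature.AlgebraicTopology.FundamentalGroup.GS3.u0 M i := fun i ↦ by simp [hQ, Literature.AlgebraicTopology.FundamentalGroup.GS3.gs]
  have e1 : ∀ i, Q.1 i 1 = Literature.AlgebraicTopology.FundamentalGroup.GS3.u1 M i := fun i ↦ by simp [hQ, Literature.AlgebraicTopology.FundamentalGroup.GS3.gs]
  have q00 : Q.1 0 0 = 0 := by rw [e0, Literature.AlgebraicTopology.FundamentalGroup.GS3.u0_apply, h00, mul_zero]
  have q10 : Q.1 1 0 = 0 := by rw [e0, Literature.AlgebraicTopology.FundamentalGroup.GS3.u0_apply, h10, mul_zero]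
  have q20 : Q.1 2 0 = 1 := by rw [e0, Literature.AlgebraicTopology.FundamentalGroup.GS3.u0_apply, h20, hA, inv_one, mul_one]
  have q21 : Q.1 2 1 = 0 := by rw [e1, hu1]; rfl
  have q01 : Q.1 0 1 = M 0 1 / Real.sqrt (M 0 1 ^ 2 + M 1 1 ^ 2) := by rw [e1, hu1]; rfl
  have q11 : Q.1 1 1 = M 1 1 / Real.sqrt (M 0 1 ^ 2 + M 1 1 ^ 2) := by rw [e1, hu1]; rfl
  have := (Literature.AlgebraicTopology.FundamentalGroup.SO3.eq_gompfGS Q q00 q10 q20 q21).1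
  rw [q01, q11] at this
  exact this

/-- **Gompf's `p₀`**: the unit quaternion `(1 - i - j - k)/2`, a lift of the cyclic permutation
matrix `P₀ = G(1, 0)` (rotation by `2π/3` about `(1, 1, 1)`). [folklore] -/
def quatP0 : ℍ := ⟨1 / 2, -(1 / 2), -(1 / 2), -(1 / 2)⟩

/-- `quatRot p₀ = P₀ = G(1, 0)`. [folklore] -/
theorem quatRot_quatP0 : Literature.AlgebraicTopology.FundamentalGroup.quatRot quatP0 = gompfGS 1 0 := by
  ext i j
  fin_cases i <;> fin_cases j <;> norm_num [Literature.AlgebraicTopology.FundamentalGroup.quatRot, quatP0, gompfGS]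

/-- `|p₀| = 1`. [folklore] -/
theorem normSq_quatP0 : normSq quatP0 = 1 := by
  norm_num [normSq_def', quatP0]

/-- **The quaternion `α + β k`**, written with ring operations (for continuity). [folklore] -/
def quatZ (α β : ℝ) : ℍ := (α : ℍ) + (β : ℍ) * ⟨0, 0, 0, 1⟩

/-- Components of `α + β k`. [folklore] -/
theorem quatZ_eq (α β : ℝ) : quatZ α β = ⟨α, 0, 0, β⟩ := by
  ext <;> simp [quatZ]

/-- `α + β k` depends continuously on `(α, β)`. [folklore] -/
theorem continuous_quatZ {X : Type*} [TopologicalSpace X] {f g : X → ℝ} (hf : Continuous f)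
    (hg : Continuous g) : Continuous fun x ↦ quatZ (f x) (g x) :=
  (continuous_coe.comp hf).add ((continuous_coe.comp hg).mul continuous_const)

/-- `quatRot (α + β k)` is the rotation about the third axis with cosine `α² - β²` and sine `2αβ`
(for `α² + β² = 1`). [cite: HatcherAT2002, §3.D (φ sends x to the rotation through angle |x|π about the axis x)] -/
theorem quatRot_quatZ {α β : ℝ} (h : α ^ 2 + β ^ 2 = 1) :
    Literature.AlgebraicTopology.FundamentalGroup.quatRot (quatZ α β) = Literature.AlgebraicTopology.FundamentalGroup.rotZ (α ^ 2 - β ^ 2) (2 * (α * β)) := by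
  rw [quatZ_eq]
  ext i j
  (fin_cases i <;> fin_cases j <;> simp [Literature.AlgebraicTopology.FundamentalGroup.quatRot, Literature.AlgebraicTopology.FundamentalGroup.rotZ]); nlinarith [h]

/-- `Rot_z(c, s) · P₀ = G(c, s)`. [folklore] -/
theorem rotZ_mul_gompfGS_one_zero (c s : ℝ) : Literature.AlgebraicTopology.FundamentalGroup.rotZ c s * gompfGS 1 0 = gompfGS c s := by
  ext i j
  fin_cases i <;> fin_cases j <;> simp [Literature.AlgebraicTopology.FundamentalGroup.rotZ, gompfGS, Matrix.mul_apply, Fin.sum_univ_three]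

/-- **`quatRot ((α + β k) p₀) = G(α² - β², 2αβ)`** for `α² + β² = 1`: the rotation about the third
axis by the doubled angle, followed by `P₀`. [cite: HatcherAT2002, §3.D (φ sends x to the rotation through angle |x|π about the axis x)] -/
theorem quatRot_quatZ_mul_quatP0 {α β : ℝ} (h : α ^ 2 + β ^ 2 = 1) :
    Literature.AlgebraicTopology.FundamentalGroup.quatRot (quatZ α β * quatP0) = gompfGS (α ^ 2 - β ^ 2) (2 * (α * β)) := by
  rw [Literature.AlgebraicTopology.FundamentalGroup.quatRot_mul, quatRot_quatP0, quatRot_quatZ h, rotZ_mul_gompfGS_one_zero]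

/-- `|(α + β k) p₀|² = α² + β²`. [folklore] -/
theorem normSq_quatZ_mul_quatP0 (α β : ℝ) : normSq (quatZ α β * quatP0) = α ^ 2 + β ^ 2 := by
  rw [map_mul, normSq_quatP0, mul_one, quatZ_eq, normSq_def']
  simp

/-! #### The two half-angle branches -/

/-- The normalising factor `n = |(a, c)|`. [folklore] -/
def nrm (v : ℝ × ℝ) : ℝ := Real.sqrt (v.1 ^ 2 + v.2 ^ 2)

/-- `p = a/n`. [cite: GompfAGT2010, Thm 4.3 (proof: (a, c) up to positive scale)] -/
def pOf (v : ℝ × ℝ) : ℝ := v.1 / nrm v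

/-- `r = c/n`. [cite: GompfAGT2010, Thm 4.3 (proof: (a, c) up to positive scale)] -/
def rOf (v : ℝ × ℝ) : ℝ := v.2 / nrm v

/-- `cos(ψ/2)` on the branch `ψ ∈ (-π, π)`: `√((1 + p)/2)`. [folklore] -/
def alpha3 (v : ℝ × ℝ) : ℝ := Real.sqrt ((1 + pOf v) / 2)

/-- `sin(ψ/2)` on the branch `ψ ∈ (-π, π)`: `r / (2 cos(ψ/2))`. [folklore] -/
def beta3 (v : ℝ × ℝ) : ℝ := rOf v / (2 * alpha3 v)

/-- `sin(ψ/2)` on the branch `ψ ∈ (0, 2π)`: `√((1 - p)/2)`. [folklore] -/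
def beta5 (v : ℝ × ℝ) : ℝ := Real.sqrt ((1 - pOf v) / 2)

/-- `cos(ψ/2)` on the branch `ψ ∈ (0, 2π)`: `r / (2 sin(ψ/2))`. [folklore] -/
def alpha5 (v : ℝ × ℝ) : ℝ := rOf v / (2 * beta5 v)

/-- **The lift `(cos(ψ/2) + sin(ψ/2) k) p₀` of `G(p, r)` on the branch `ψ ∈ (-π, π)`** (valid when
`c ≠ 0` or `a > 0`). [cite: GompfAGT2010, Thm 4.3 (proof: the mod 2 winding number of (a, c))] -/
def liftF3 (v : ℝ × ℝ) : ℍ := quatZ (alpha3 v) (beta3 v) * quatP0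

/-- **The lift on the branch `ψ ∈ (0, 2π)`** (valid when `c ≠ 0` or `a < 0`). [cite: GompfAGT2010, Thm 4.3 (proof: the mod 2 winding number of (a, c))] -/
def liftF5 (v : ℝ × ℝ) : ℍ := quatZ (alpha5 v) (beta5 v) * quatP0

/-- `n > 0` away from the origin. [folklore] -/
theorem nrm_pos {v : ℝ × ℝ} (hv : v.1 ^ 2 + v.2 ^ 2 ≠ 0) : 0 < nrm v :=
  Real.sqrt_pos.2 (lt_of_le_of_ne (by positivity) (Ne.symm hv))

/-- `p² + r² = 1`. [folklore] -/
theorem pOf_sq_add_rOf_sq {v : ℝ × ℝ} (hv : v.1 ^ 2 + v.2 ^ 2 ≠ 0) : pOf v ^ 2 + rOf v ^ 2 = 1 := by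
  have hn := nrm_pos hv
  have hn2 : nrm v ^ 2 = v.1 ^ 2 + v.2 ^ 2 := Real.sq_sqrt (by positivity)
  rw [pOf, rOf, div_pow, div_pow, ← add_div, ← hn2, div_self (pow_ne_zero 2 hn.ne')]

/-- On the branch of `liftF3`, `1 + p > 0`: this holds as soon as `c ≠ 0` or `a > 0`. [folklore] -/
theorem one_add_pOf_pos {v : ℝ × ℝ} (hv : v.2 ≠ 0 ∨ 0 < v.1) : 0 < 1 + pOf v := by
  have hv' : v.1 ^ 2 + v.2 ^ 2 ≠ 0 := by
    rcases hv with h | h <;> positivity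
  have hn := nrm_pos hv'
  have hn2 : nrm v ^ 2 = v.1 ^ 2 + v.2 ^ 2 := Real.sq_sqrt (by positivity)
  have key : -nrm v < v.1 := by
    rcases hv with h | h
    · by_contra hc
      have hc' : v.1 ≤ -nrm v := not_lt.1 hc
      have h2 : 0 < v.2 ^ 2 := by positivity
      have hprod : 0 ≤ (v.1 + nrm v) * (v.1 - nrm v) :=
        mul_nonneg_of_nonpos_of_nonpos (by linarith) (by linarith)
      nlinarith
    · linarith
  rw [pOf, ← div_self hn.ne', ← add_div]
  exact div_pos (by linarith) hn

/-- On the branch of `liftF5`, `1 - p > 0`: this holds as soon as `c ≠ 0` or `a < 0`. [folklore] -/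
theorem one_sub_pOf_pos {v : ℝ × ℝ} (hv : v.2 ≠ 0 ∨ v.1 < 0) : 0 < 1 - pOf v := by
  have h := one_add_pOf_pos (v := (-v.1, v.2)) (by simpa using hv)
  have e : pOf (-v.1, v.2) = -pOf v := by simp [pOf, nrm, neg_div]
  rw [e] at h
  linarith

/-- **The branch `liftF3` is a half-angle point**: `α² + β² = 1`, `α² - β² = p`, `2αβ = r`. [folklore] -/
theorem alpha3_beta3 {v : ℝ × ℝ} (hv : v.2 ≠ 0 ∨ 0 < v.1) :
    alpha3 v ^ 2 + beta3 v ^ 2 = 1 ∧ alpha3 v ^ 2 - beta3 v ^ 2 = pOf v ∧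
      2 * (alpha3 v * beta3 v) = rOf v := by
  have hv' : v.1 ^ 2 + v.2 ^ 2 ≠ 0 := by
    rcases hv with h | h <;> positivity
  have hp := one_add_pOf_pos hv
  have hpr := pOf_sq_add_rOf_sq hv'
  have ha2 : alpha3 v ^ 2 = (1 + pOf v) / 2 := Real.sq_sqrt (by linarith)
  have ha : 0 < alpha3 v := Real.sqrt_pos.2 (by linarith)
  have hb : beta3 v = rOf v / (2 * alpha3 v) := rfl
  have ha0 : alpha3 v ≠ 0 := ha.ne'
  have hb2 : beta3 v ^ 2 = (1 - pOf v) / 2 := by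
    rw [hb, div_pow, mul_pow, ha2]
    field_simp
    nlinarith
  refine ⟨by rw [ha2, hb2]; ring, by rw [ha2, hb2]; ring, ?_⟩
  rw [hb]
  field_simp

/-- **The branch `liftF5` is a half-angle point**: `α² + β² = 1`, `α² - β² = p`, `2αβ = r`. [folklore] -/
theorem alpha5_beta5 {v : ℝ × ℝ} (hv : v.2 ≠ 0 ∨ v.1 < 0) :
    alpha5 v ^ 2 + beta5 v ^ 2 = 1 ∧ alpha5 v ^ 2 - beta5 v ^ 2 = pOf v ∧
      2 * (alpha5 v * beta5 v) = rOf v := by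
  have hv' : v.1 ^ 2 + v.2 ^ 2 ≠ 0 := by
    rcases hv with h | h
    · positivity
    · have := h.ne; positivity
  have hp := one_sub_pOf_pos hv
  have hpr := pOf_sq_add_rOf_sq hv'
  have hb2 : beta5 v ^ 2 = (1 - pOf v) / 2 := Real.sq_sqrt (by linarith)
  have hb : 0 < beta5 v := Real.sqrt_pos.2 (by linarith)
  have ha : alpha5 v = rOf v / (2 * beta5 v) := rfl
  have hb0 : beta5 v ≠ 0 := hb.ne'
  have ha2 : alpha5 v ^ 2 = (1 + pOf v) / 2 := by
    rw [ha, div_pow, mul_pow, hb2]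
    field_simp
    nlinarith
  refine ⟨by rw [ha2, hb2]; ring, by rw [ha2, hb2]; ring, ?_⟩
  rw [ha]
  field_simp

/-- `liftF3 v` is a unit quaternion. [folklore] -/
theorem normSq_liftF3 {v : ℝ × ℝ} (hv : v.2 ≠ 0 ∨ 0 < v.1) : normSq (liftF3 v) = 1 := by
  rw [liftF3, normSq_quatZ_mul_quatP0, (alpha3_beta3 hv).1]

/-- `liftF5 v` is a unit quaternion. [folklore] -/
theorem normSq_liftF5 {v : ℝ × ℝ} (hv : v.2 ≠ 0 ∨ v.1 < 0) : normSq (liftF5 v) = 1 := by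
  rw [liftF5, normSq_quatZ_mul_quatP0, (alpha5_beta5 hv).1]

/-- **`liftF3 v` lifts `G(p, r)`.** [cite: GompfAGT2010, Thm 4.3 (proof: the mod 2 winding number of (a, c))] -/
theorem quatRot_liftF3 {v : ℝ × ℝ} (hv : v.2 ≠ 0 ∨ 0 < v.1) :
    Literature.AlgebraicTopology.FundamentalGroup.quatRot (liftF3 v) = gompfGS (pOf v) (rOf v) := by
  obtain ⟨h1, h2, h3⟩ := alpha3_beta3 hv
  rw [liftF3, quatRot_quatZ_mul_quatP0 h1, h2, h3]

/-- **`liftF5 v` lifts `G(p, r)`.** [cite: GompfAGT2010, Thm 4.3 (proof: the mod 2 winding number of (a, c))] -/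
theorem quatRot_liftF5 {v : ℝ × ℝ} (hv : v.2 ≠ 0 ∨ v.1 < 0) :
    Literature.AlgebraicTopology.FundamentalGroup.quatRot (liftF5 v) = gompfGS (pOf v) (rOf v) := by
  obtain ⟨h1, h2, h3⟩ := alpha5_beta5 hv
  rw [liftF5, quatRot_quatZ_mul_quatP0 h1, h2, h3]

/-- The product `cos(ψ/2) sin(ψ/2)`-type identity: `√((1+p)/2) √((1-p)/2) = |r| / 2`. [folklore] -/
theorem sqrt_half_mul_sqrt_half {p r : ℝ} (hpr : p ^ 2 + r ^ 2 = 1) :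
    Real.sqrt ((1 + p) / 2) * Real.sqrt ((1 - p) / 2) = |r| / 2 := by
  have hp1 : -1 ≤ p := by nlinarith [sq_nonneg r]
  have hp2 : p ≤ 1 := by nlinarith [sq_nonneg r]
  rw [← Real.sqrt_mul (by linarith), show (1 + p) / 2 * ((1 - p) / 2) = (r / 2) ^ 2 by nlinarith,
    Real.sqrt_sq_eq_abs, abs_div, abs_two]

/-- **The two branches agree where `r > 0`** (`ψ ∈ (0, π)`). [folklore] -/
theorem liftF3_eq_liftF5 {v : ℝ × ℝ} (hv : 0 < v.2) : liftF3 v = liftF5 v := by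
  have hv' : v.1 ^ 2 + v.2 ^ 2 ≠ 0 := by positivity
  have hpr := pOf_sq_add_rOf_sq hv'
  have hr : 0 < rOf v := div_pos hv (nrm_pos hv')
  have hp := one_add_pOf_pos (Or.inl hv.ne')
  have hq := one_sub_pOf_pos (Or.inl hv.ne')
  have ha : 0 < alpha3 v := Real.sqrt_pos.2 (by linarith)
  have hb : 0 < beta5 v := Real.sqrt_pos.2 (by linarith)
  have key : alpha3 v * beta5 v = rOf v / 2 := by
    have := sqrt_half_mul_sqrt_half hpr
    rwa [abs_of_pos hr] at this
  have e1 : alpha3 v = alpha5 v := by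
    rw [alpha5, eq_div_iff (mul_pos two_pos hb).ne']
    linarith
  have e2 : beta3 v = beta5 v := by
    rw [beta3, div_eq_iff (mul_pos two_pos ha).ne']
    linarith
  rw [liftF3, liftF5, e1, e2]

/-- **At the base point `(a, c) = (-1, -1)` the two branches are antipodal**: going once around,
the lift ends at minus its starting point. [cite: GompfAGT2010, Thm 4.3 (proof: the mod 2 winding number of (a, c) is nonzero by inspection)] -/
theorem liftF5_base : liftF5 (-1, -1) = -liftF3 (-1, -1) := by
  have hv : ((-1 : ℝ), (-1 : ℝ)).1 ^ 2 + ((-1 : ℝ), (-1 : ℝ)).2 ^ 2 ≠ 0 := by norm_num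
  have hpr := pOf_sq_add_rOf_sq hv
  have hr : rOf (-1, -1) < 0 := div_neg_of_neg_of_pos (by norm_num) (nrm_pos hv)
  have hp := one_add_pOf_pos (v := (-1, -1)) (Or.inl (by norm_num))
  have hq := one_sub_pOf_pos (v := (-1, -1)) (Or.inl (by norm_num))
  have ha : 0 < alpha3 (-1, -1) := Real.sqrt_pos.2 (by linarith)
  have hb : 0 < beta5 (-1, -1) := Real.sqrt_pos.2 (by linarith)
  have key : alpha3 (-1, -1) * beta5 (-1, -1) = -rOf (-1, -1) / 2 := by
    have := sqrt_half_mul_sqrt_half hpr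
    rwa [abs_of_neg hr] at this
  have e1 : alpha5 (-1, -1) = -alpha3 (-1, -1) := by
    rw [alpha5, div_eq_iff (mul_pos two_pos hb).ne']
    linarith
  have e2 : beta5 (-1, -1) = -beta3 (-1, -1) := by
    have e2' : beta3 (-1, -1) = -beta5 (-1, -1) := by
      rw [beta3, div_eq_iff (mul_pos two_pos ha).ne']
      linarith
    rw [e2', neg_neg]
  have hneg : ∀ α β : ℝ, quatZ (-α) (-β) = -quatZ α β := fun α β ↦ by
    rw [quatZ_eq, quatZ_eq]
    ext <;> simp
  rw [liftF5, liftF3, e1, e2, hneg, neg_mul]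

/-- `liftF3` is continuous along any continuous plane curve staying in its branch. [folklore] -/
theorem continuous_liftF3 {X : Type*} [TopologicalSpace X] {f : X → ℝ × ℝ} (hf : Continuous f)
    (h : ∀ x, (f x).2 ≠ 0 ∨ 0 < (f x).1) : Continuous fun x ↦ liftF3 (f x) := by
  have hn : Continuous fun x ↦ nrm (f x) := Real.continuous_sqrt.comp (by fun_prop)
  have hn' : ∀ x, nrm (f x) ≠ 0 := fun x ↦ (nrm_pos (by
    rcases h x with h' | h' <;> positivity)).ne'
  have hp : Continuous fun x ↦ pOf (f x) := (continuous_fst.comp hf).div hn hn'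
  have hr : Continuous fun x ↦ rOf (f x) := (continuous_snd.comp hf).div hn hn'
  have ha : Continuous fun x ↦ alpha3 (f x) :=
    Real.continuous_sqrt.comp ((continuous_const.add hp).div_const _)
  have ha' : ∀ x, 2 * alpha3 (f x) ≠ 0 := fun x ↦ by
    have := one_add_pOf_pos (h x)
    have : 0 < alpha3 (f x) := Real.sqrt_pos.2 (by linarith)
    positivity
  have hb : Continuous fun x ↦ beta3 (f x) := hr.div (continuous_const.mul ha) ha'
  exact (continuous_quatZ ha hb).mul continuous_const

/-- `liftF5` is continuous along any continuous plane curve staying in its branch. [folklore] -/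
theorem continuous_liftF5 {X : Type*} [TopologicalSpace X] {f : X → ℝ × ℝ} (hf : Continuous f)
    (h : ∀ x, (f x).2 ≠ 0 ∨ (f x).1 < 0) : Continuous fun x ↦ liftF5 (f x) := by
  have hn : Continuous fun x ↦ nrm (f x) := Real.continuous_sqrt.comp (by fun_prop)
  have hn' : ∀ x, nrm (f x) ≠ 0 := fun x ↦ (nrm_pos (by
    rcases h x with h' | h'
    · positivity
    · have := h'.ne; positivity)).ne'
  have hp : Continuous fun x ↦ pOf (f x) := (continuous_fst.comp hf).div hn hn'
  have hr : Continuous fun x ↦ rOf (f x) := (continuous_snd.comp hf).div hn hn'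
  have hb : Continuous fun x ↦ beta5 (f x) :=
    Real.continuous_sqrt.comp ((continuous_const.sub hp).div_const _)
  have hb' : ∀ x, 2 * beta5 (f x) ≠ 0 := fun x ↦ by
    have := one_sub_pOf_pos (h x)
    have : 0 < beta5 (f x) := Real.sqrt_pos.2 (by linarith)
    positivity
  have ha : Continuous fun x ↦ alpha5 (f x) := hr.div (continuous_const.mul hb) hb'
  exact (continuous_quatZ ha hb).mul continuous_const

end Frames

/-! ### The retracted segments and their lifts -/

section Segments

open GS3 Literature.AlgebraicTopology.FundamentalGroup.GLPos3

/-- **The second-column data `(a, c)` of a matrix.** [cite: GompfAGT2010, Thm 4.3 (proof: the second column [a c e]ᵀ)] -/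
def acOf (M : Matrix (Fin 3) (Fin 3) ℝ) : ℝ × ℝ := (M 0 1, M 1 1)

/-- **The Gram–Schmidt retraction of a matrix with first column `e₃` is `G(p, r)`.** [cite: GompfAGT2010, Thm 4.3 (proof: Gram–Schmidt keeps the first column e₃ and scales (a, c))] -/
theorem coe_retr_eq_gompfGS (M : Literature.AlgebraicTopology.FundamentalGroup.GLPos3) (h00 : M.1 0 0 = 0) (h10 : M.1 1 0 = 0) (h20 : M.1 2 0 = 1) :
    (retr M).1 = gompfGS (pOf (acOf M.1)) (rOf (acOf M.1)) := by
  rw [coe_retr, gs_eq_gompfGS M.2 h00 h10 h20]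
  rfl

/-- **The straight segment between two matrices of the chain, as a plane curve `(a, c)`**:
entrywise affine. [cite: GompfAGT2010, Thm 4.3 (proof: linearly connecting the five matrices)] -/
theorem acOf_segmentPath (A B : Matrix.SpecialLinearGroup (Fin 3) ℤ)
    (h : ∀ t ∈ I, 0 < ((1 - t) • (slPoint A).1 + t • (slPoint B).1).det) (t : I) :
    acOf (segmentPath (slPoint A) (slPoint B) h t).1 =
      ((1 - (t : ℝ)) * (A : Matrix (Fin 3) (Fin 3) ℤ) 0 1 + (t : ℝ) * (B : Matrix (Fin 3) (Fin 3) ℤ) 0 1,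
       (1 - (t : ℝ)) * (A : Matrix (Fin 3) (Fin 3) ℤ) 1 1 + (t : ℝ) * (B : Matrix (Fin 3) (Fin 3) ℤ) 1 1) := by
  simp [acOf, coe_segmentPath_apply, Matrix.add_apply, Matrix.smul_apply, slRealMatrix_apply]

/-- Along a segment between matrices in standard form the first column stays `e₃`. [cite: GompfAGT2010, Thm 4.3 (proof: each matrix in τ·ρ has first column [0 0 1]ᵀ)] -/
theorem segmentPath_col_zero (A B : Matrix.SpecialLinearGroup (Fin 3) ℤ) (hA : IsGompfStandardForm A)
    (hB : IsGompfStandardForm B)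
    (h : ∀ t ∈ I, 0 < ((1 - t) • (slPoint A).1 + t • (slPoint B).1).det) (t : I) :
    (segmentPath (slPoint A) (slPoint B) h t).1 0 0 = 0 ∧
      (segmentPath (slPoint A) (slPoint B) h t).1 1 0 = 0 ∧
        (segmentPath (slPoint A) (slPoint B) h t).1 2 0 = 1 := by
  obtain ⟨a0, a1, a2⟩ := hA
  obtain ⟨b0, b1, b2⟩ := hB
  simp only [coe_segmentPath_apply, Matrix.add_apply, Matrix.smul_apply,
    slRealMatrix_apply, a0, a1, a2, b0, b1, b2, smul_eq_mul]
  norm_num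

/-- **A lifted segment.** Given matrices `A, B` of the chain (standard form), a branch `F` of the
lift valid along the plane segment from `(a, c)(A)` to `(a, c)(B)`, the path
`t ↦ F((1 - t)(a, c)(A) + t (a, c)(B))` in `S³` projects under `S³ → SO(3)` onto the Gram–Schmidt
retraction of the matrix segment. This packages the pointwise identity. [cite: GompfAGT2010, Thm 4.3 (proof: the mod 2 winding number of (a, c))] -/
theorem rotHom_lift_segment (A B : Matrix.SpecialLinearGroup (Fin 3) ℤ) (hA : IsGompfStandardForm A)
    (hB : IsGompfStandardForm B)
    (h : ∀ t ∈ I, 0 < ((1 - t) • (slPoint A).1 + t • (slPoint B).1).det)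
    (F : ℝ × ℝ → ℍ) (valid : ℝ × ℝ → Prop)
    (hF : ∀ v, valid v → normSq (F v) = 1 ∧ Literature.AlgebraicTopology.FundamentalGroup.quatRot (F v) = gompfGS (pOf v) (rOf v)) (t : I)
    (ht : valid (acOf (segmentPath (slPoint A) (slPoint B) h t).1)) :
    Literature.AlgebraicTopology.FundamentalGroup.quatRot (F (acOf (segmentPath (slPoint A) (slPoint B) h t).1)) =
      (retr (segmentPath (slPoint A) (slPoint B) h t)).1 := by
  obtain ⟨c0, c1, c2⟩ := segmentPath_col_zero A B hA hB h t
  rw [coe_retr_eq_gompfGS _ c0 c1 c2, (hF _ ht).2]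

end Segments

/-! ### The five lifted segments of `τ·ρ` -/

section Lift

open GS3 Literature.AlgebraicTopology.FundamentalGroup.GLPos3

/-- Standard form of the five matrices (first column `e₃`). [cite: GompfAGT2010, Thm 4.3 (proof: each matrix in τ·ρ has first column [0 0 1]ᵀ)] -/
theorem isGompfStandardForm_gompfChainOne : IsGompfStandardForm gompfChainOne := by
  simp [IsGompfStandardForm]

/-- Standard form of `B`. [cite: GompfAGT2010, Thm 4.3 (proof: each matrix in τ·ρ has first column [0 0 1]ᵀ)] -/
theorem isGompfStandardForm_gompfFramingB : IsGompfStandardForm gompfFramingB := by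
  simp [IsGompfStandardForm]

/-- Branch validity for `liftF3`: `c ≠ 0 ∨ a > 0`. [folklore] -/
def Valid3 (v : ℝ × ℝ) : Prop := v.2 ≠ 0 ∨ 0 < v.1

/-- Branch validity for `liftF5`: `c ≠ 0 ∨ a < 0`. [folklore] -/
def Valid5 (v : ℝ × ℝ) : Prop := v.2 ≠ 0 ∨ v.1 < 0

/-- `liftF3` is a valid lift on its branch. [folklore] -/
theorem liftF3_valid (v : ℝ × ℝ) (hv : Valid3 v) :
    normSq (liftF3 v) = 1 ∧ Literature.AlgebraicTopology.FundamentalGroup.quatRot (liftF3 v) = gompfGS (pOf v) (rOf v) :=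
  ⟨normSq_liftF3 hv, quatRot_liftF3 hv⟩

/-- `liftF5` is a valid lift on its branch. [folklore] -/
theorem liftF5_valid (v : ℝ × ℝ) (hv : Valid5 v) :
    normSq (liftF5 v) = 1 ∧ Literature.AlgebraicTopology.FundamentalGroup.quatRot (liftF5 v) = gompfGS (pOf v) (rOf v) :=
  ⟨normSq_liftF5 hv, quatRot_liftF5 hv⟩

/-- Points of the branches are away from the origin. [folklore] -/
theorem Valid3.ne (v : ℝ × ℝ) (hv : Valid3 v) : v.1 ^ 2 + v.2 ^ 2 ≠ 0 := by
  rcases hv with h | h <;> positivity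

/-- Points of the branches are away from the origin. [folklore] -/
theorem Valid5.ne (v : ℝ × ℝ) (hv : Valid5 v) : v.1 ^ 2 + v.2 ^ 2 ≠ 0 := by
  rcases hv with h | h
  · positivity
  · have := h.ne; positivity

/-- A unit quaternion as a point of `S³ = Metric.sphere (0 : ℍ) 1`. [folklore] -/
def toSphere (q : ℍ) (hq : normSq q = 1) : Metric.sphere (0 : ℍ) 1 :=
  ⟨q, by rw [mem_sphere_zero_iff_norm, ← Real.sqrt_mul_self (norm_nonneg _),
    ← normSq_eq_norm_mul_self, hq, Real.sqrt_one]⟩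

/-- **Segment 1 of `τ·ρ` in the plane**: `(a, c)` from `(-1, -1)` to `(1, -1)` (bottom side). [cite: GompfAGT2010, Thm 4.3 (proof: the second columns of the five matrices)] -/
theorem acOf_gompfSegment₁ (t : I) :
    acOf (gompfSegment₁ t).1 = (-1 + 2 * (t : ℝ), -1) := by
  rw [gompfSegment₁, acOf_segmentPath]
  refine Prod.ext ?_ ?_ <;> simp <;> ring

/-- **Segment 2**: `(a, c)` constant `(1, -1)`. [cite: GompfAGT2010, Thm 4.3 (proof: the second columns of the five matrices)] -/
theorem acOf_gompfSegment₂ (t : I) : acOf (gompfSegment₂ t).1 = (1, -1) := by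
  rw [gompfSegment₂, acOf_segmentPath]
  (refine Prod.ext ?_ ?_ <;> simp); ring

/-- **Segment 3**: `(a, c)` from `(1, -1)` to `(1, 1)` (right side). [cite: GompfAGT2010, Thm 4.3 (proof: the second columns of the five matrices)] -/
theorem acOf_gompfSegment₃ (t : I) : acOf (gompfSegment₃ t).1 = (1, -1 + 2 * (t : ℝ)) := by
  rw [gompfSegment₃, acOf_segmentPath]
  (refine Prod.ext ?_ ?_ <;> simp); ring

/-- **Segment 4**: `(a, c)` from `(1, 1)` to `(-1, 1)` (top side). [cite: GompfAGT2010, Thm 4.3 (proof: the second columns of the five matrices)] -/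
theorem acOf_gompfSegment₄ (t : I) : acOf (gompfSegment₄ t).1 = (1 - 2 * (t : ℝ), 1) := by
  rw [gompfSegment₄, acOf_segmentPath]
  (refine Prod.ext ?_ ?_ <;> simp); ring

/-- **Segment 5** (the closing segment `ρ⁻¹` from `B` to `A`): `(a, c)` from `(-1, 1)` to
`(-1, -1)` (left side). [cite: GompfAGT2010, Thm 4.3 (proof: the second columns of the five matrices)] -/
theorem acOf_gompfSegment₅ (t : I) :
    acOf (segmentPath (slPoint gompfFramingB) (slPoint gompfFramingA) det_segment_gompfFraming_pos' t).1 =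
      (-1, 1 - 2 * (t : ℝ)) := by
  rw [acOf_segmentPath]
  refine Prod.ext ?_ ?_ <;> simp <;> ring

/-- The plane curve of segment `i` (`i = 1, …, 5`), as a function of the segment parameter. [cite: GompfAGT2010, Thm 4.3 (proof: the second columns of the five matrices)] -/
def planeSeg (i : Fin 5) (t : I) : ℝ × ℝ :=
  ![(-1 + 2 * (t : ℝ), -1), (1, -1), (1, -1 + 2 * (t : ℝ)), (1 - 2 * (t : ℝ), 1), (-1, 1 - 2 * (t : ℝ))] i

/-- The plane curves are continuous. [folklore] -/
theorem continuous_planeSeg (i : Fin 5) : Continuous (planeSeg i) := by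
  unfold planeSeg
  fin_cases i <;> simp <;> exact ⟨by fun_prop, by fun_prop⟩

/-- Segments 1–4 stay in the branch of `liftF3`. [folklore] -/
theorem valid3_planeSeg (i : Fin 5) (hi : i ≠ 4) (t : I) : Valid3 (planeSeg i t) := by
  fin_cases i <;> simp [planeSeg, Valid3] at hi ⊢

/-- Segment 5 stays in the branch of `liftF5`. [folklore] -/
theorem valid5_planeSeg_four (t : I) : Valid5 (planeSeg 4 t) := by
  simp [planeSeg, Valid5]

/-- **The lift of segment `i ≤ 4`** as a map into `S³`. [cite: GompfAGT2010, Thm 4.3 (proof: the mod 2 winding number of (a, c))] -/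
def liftSeg3 (i : Fin 5) (hi : i ≠ 4) (t : I) : Metric.sphere (0 : ℍ) 1 :=
  toSphere (liftF3 (planeSeg i t)) (normSq_liftF3 (valid3_planeSeg i hi t))

/-- **The lift of segment 5** as a map into `S³`. [cite: GompfAGT2010, Thm 4.3 (proof: the mod 2 winding number of (a, c))] -/
def liftSeg5 (t : I) : Metric.sphere (0 : ℍ) 1 :=
  toSphere (liftF5 (planeSeg 4 t)) (normSq_liftF5 (valid5_planeSeg_four t))

/-- The lifts are continuous. [folklore] -/
theorem continuous_liftSeg3 (i : Fin 5) (hi : i ≠ 4) : Continuous (liftSeg3 i hi) :=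
  (continuous_liftF3 (continuous_planeSeg i) (valid3_planeSeg i hi)).subtype_mk _

/-- The lift of segment 5 is continuous. [folklore] -/
theorem continuous_liftSeg5 : Continuous liftSeg5 :=
  (continuous_liftF5 (continuous_planeSeg 4) valid5_planeSeg_four).subtype_mk _

/-- The lifted segment `i ≤ 4` as a path in `S³`. [cite: GompfAGT2010, Thm 4.3 (proof: the mod 2 winding number of (a, c))] -/
def liftPath3 (i : Fin 5) (hi : i ≠ 4) : Path (liftSeg3 i hi 0) (liftSeg3 i hi 1) where
  toFun := liftSeg3 i hi
  continuous_toFun := continuous_liftSeg3 i hi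
  source' := rfl
  target' := rfl

/-- The lifted segment 5 as a path in `S³`. [cite: GompfAGT2010, Thm 4.3 (proof: the mod 2 winding number of (a, c))] -/
def liftPath5 : Path (liftSeg5 0) (liftSeg5 1) where
  toFun := liftSeg5
  continuous_toFun := continuous_liftSeg5
  source' := rfl
  target' := rfl

/-- The vertices match: end of segment 1 = start of segment 2. [folklore] -/
theorem liftSeg3_one_zero : liftSeg3 0 (by decide) 1 = liftSeg3 1 (by decide) 0 := by
  apply Subtype.ext
  show liftF3 (-1 + 2 * ((1 : I) : ℝ), -1) = liftF3 (1, -1)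
  norm_num

/-- End of segment 2 = start of segment 3. [folklore] -/
theorem liftSeg3_two_zero : liftSeg3 1 (by decide) 1 = liftSeg3 2 (by decide) 0 := by
  apply Subtype.ext
  show liftF3 (1, -1) = liftF3 (1, -1 + 2 * ((0 : I) : ℝ))
  norm_num

/-- End of segment 3 = start of segment 4. [folklore] -/
theorem liftSeg3_three_zero : liftSeg3 2 (by decide) 1 = liftSeg3 3 (by decide) 0 := by
  apply Subtype.ext
  show liftF3 (1, -1 + 2 * ((1 : I) : ℝ)) = liftF3 (1 - 2 * ((0 : I) : ℝ), 1)
  norm_num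

/-- End of segment 4 = start of segment 5 (here the branches are switched, at the vertex
`(a, c) = (-1, 1)` where `r > 0`). [folklore] -/
theorem liftSeg3_four_zero : liftSeg3 3 (by decide) 1 = liftSeg5 0 := by
  apply Subtype.ext
  show liftF3 (1 - 2 * ((1 : I) : ℝ), 1) = liftF5 (-1, 1 - 2 * ((0 : I) : ℝ))
  norm_num
  exact liftF3_eq_liftF5 (by norm_num)

/-- **Going once around, the lift ends at minus its start.** [cite: GompfAGT2010, Thm 4.3 (proof: the mod 2 winding number of (a, c) is nonzero by inspection)] -/
theorem liftSeg5_one : ((liftSeg5 1 : Metric.sphere (0 : ℍ) 1) : ℍ) = -(liftSeg3 0 (by decide) 0 : ℍ) := by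
  show liftF5 (-1, 1 - 2 * ((1 : I) : ℝ)) = -liftF3 (-1 + 2 * ((0 : I) : ℝ), -1)
  norm_num
  exact liftF5_base

/-- **The whole lift `Γ` of `r ∘ (τ·ρ)`** to `S³`, glued along the same bracketting as
`gompfFramingLoop = (((s₁ s₂) s₃) s₄) s₅`. [cite: GompfAGT2010, Thm 4.3 (proof: the mod 2 winding number of (a, c))] -/
def gompfLoopLift : Path (liftSeg3 0 (by decide) 0) (liftSeg5 1) :=
  (((((liftPath3 0 (by decide)).trans ((liftPath3 1 (by decide)).cast liftSeg3_one_zero rfl)).trans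
    ((liftPath3 2 (by decide)).cast liftSeg3_two_zero rfl)).trans
      ((liftPath3 3 (by decide)).cast liftSeg3_three_zero rfl)).trans
        (liftPath5.cast liftSeg3_four_zero rfl))

/-- Composition with maps commutes with concatenation in parallel: if `f ∘ p₁ = g ∘ q₁` and
`f ∘ p₂ = g ∘ q₂` pointwise then `f ∘ (p₁ · p₂) = g ∘ (q₁ · q₂)`. [folklore] -/
theorem comp_trans_eq {X Y Z : Type*} [TopologicalSpace X] [TopologicalSpace Y] {x₀ x₁ x₂ : X}
    {y₀ y₁ y₂ : Y} (f : X → Z) (g : Y → Z) (p₁ : Path x₀ x₁) (p₂ : Path x₁ x₂) (q₁ : Path y₀ y₁)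
    (q₂ : Path y₁ y₂) (h₁ : ∀ t, f (p₁ t) = g (q₁ t)) (h₂ : ∀ t, f (p₂ t) = g (q₂ t)) (t : I) :
    f (p₁.trans p₂ t) = g (q₁.trans q₂ t) := by
  rw [Path.trans_apply, Path.trans_apply]
  split_ifs with h
  · exact h₁ _
  · exact h₂ _

/-- **`Γ` lifts `r ∘ (τ·ρ)`**: segment by segment, the quaternion lift projects under `S³ → SO(3)`
to the Gram–Schmidt retraction of the matrix segment. [cite: GompfAGT2010, Thm 4.3 (proof: the mod 2 winding number of (a, c))] -/
theorem rotHom_gompfLift (t : I) : Literature.AlgebraicTopology.FundamentalGroup.rotHom (gompfLoopLift t) = retr (gompfFramingLoop t) := by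
  have hA := isGompfStandardForm_gompfFramingA
  have h1 := isGompfStandardForm_gompfChainOne
  have h2 := isGompfStandardForm_gompfChainTwo
  have h0 := isGompfStandardForm_akbulutKirbyMatrix
  have hB := isGompfStandardForm_gompfFramingB
  -- the five pointwise identities
  have s1 : ∀ t, Literature.AlgebraicTopology.FundamentalGroup.rotHom (liftPath3 0 (by decide) t) = retr (gompfSegment₁ t) := fun t ↦ by
    apply Subtype.ext
    rw [Literature.AlgebraicTopology.FundamentalGroup.coe_rotHom]
    show Literature.AlgebraicTopology.FundamentalGroup.quatRot (liftF3 (planeSeg 0 t)) = _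
    rw [show planeSeg 0 t = acOf (gompfSegment₁ t).1 from (acOf_gompfSegment₁ t).symm]
    exact rotHom_lift_segment _ _ hA h1 _ liftF3 Valid3 liftF3_valid t
      (by rw [← gompfSegment₁, acOf_gompfSegment₁]; exact valid3_planeSeg 0 (by decide) t)
  have s2 : ∀ t, Literature.AlgebraicTopology.FundamentalGroup.rotHom (((liftPath3 1 (by decide)).cast liftSeg3_one_zero rfl) t) =
      retr (gompfSegment₂ t) := fun t ↦ by
    apply Subtype.ext
    rw [Literature.AlgebraicTopology.FundamentalGroup.coe_rotHom]
    show Literature.AlgebraicTopology.FundamentalGroup.quatRot (liftF3 (planeSeg 1 t)) = _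
    rw [show planeSeg 1 t = acOf (gompfSegment₂ t).1 from (acOf_gompfSegment₂ t).symm]
    exact rotHom_lift_segment _ _ h1 h2 _ liftF3 Valid3 liftF3_valid t
      (by rw [← gompfSegment₂, acOf_gompfSegment₂]; exact valid3_planeSeg 1 (by decide) t)
  have s3 : ∀ t, Literature.AlgebraicTopology.FundamentalGroup.rotHom (((liftPath3 2 (by decide)).cast liftSeg3_two_zero rfl) t) =
      retr (gompfSegment₃ t) := fun t ↦ by
    apply Subtype.ext
    rw [Literature.AlgebraicTopology.FundamentalGroup.coe_rotHom]
    show Literature.AlgebraicTopology.FundamentalGroup.quatRot (liftF3 (planeSeg 2 t)) = _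
    rw [show planeSeg 2 t = acOf (gompfSegment₃ t).1 from (acOf_gompfSegment₃ t).symm]
    exact rotHom_lift_segment _ _ h2 h0 _ liftF3 Valid3 liftF3_valid t
      (by rw [← gompfSegment₃, acOf_gompfSegment₃]; exact valid3_planeSeg 2 (by decide) t)
  have s4 : ∀ t, Literature.AlgebraicTopology.FundamentalGroup.rotHom (((liftPath3 3 (by decide)).cast liftSeg3_three_zero rfl) t) =
      retr (gompfSegment₄ t) := fun t ↦ by
    apply Subtype.ext
    rw [Literature.AlgebraicTopology.FundamentalGroup.coe_rotHom]
    show Literature.AlgebraicTopology.FundamentalGroup.quatRot (liftF3 (planeSeg 3 t)) = _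
    rw [show planeSeg 3 t = acOf (gompfSegment₄ t).1 from (acOf_gompfSegment₄ t).symm]
    exact rotHom_lift_segment _ _ h0 hB _ liftF3 Valid3 liftF3_valid t
      (by rw [← gompfSegment₄, acOf_gompfSegment₄]; exact valid3_planeSeg 3 (by decide) t)
  have s5 : ∀ t, Literature.AlgebraicTopology.FundamentalGroup.rotHom ((liftPath5.cast liftSeg3_four_zero rfl) t) =
      retr (segmentPath (slPoint gompfFramingB) (slPoint gompfFramingA) det_segment_gompfFraming_pos' t) :=
    fun t ↦ by
    apply Subtype.ext
    rw [Literature.AlgebraicTopology.FundamentalGroup.coe_rotHom]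
    show Literature.AlgebraicTopology.FundamentalGroup.quatRot (liftF5 (planeSeg 4 t)) = _
    rw [show planeSeg 4 t = acOf (segmentPath (slPoint gompfFramingB) (slPoint gompfFramingA)
      det_segment_gompfFraming_pos' t).1 from (acOf_gompfSegment₅ t).symm]
    exact rotHom_lift_segment _ _ hB hA _ liftF5 Valid5 liftF5_valid t
      (by rw [acOf_gompfSegment₅]; exact valid5_planeSeg_four t)
  -- glue
  rw [gompfLoopLift, gompfFramingLoop, gompfTau]
  refine comp_trans_eq _ _ _ _ _ _ (fun t ↦ ?_) s5 t
  refine comp_trans_eq _ _ _ _ _ _ (fun t ↦ ?_) s4 t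
  refine comp_trans_eq _ _ _ _ _ _ (fun t ↦ ?_) s3 t
  exact comp_trans_eq _ _ _ _ _ _ s1 s2 t

end Lift

/-! ### P2 -/

section Essential

open GS3 Literature.AlgebraicTopology.FundamentalGroup.GLPos3

/-- **P2 discharged: Gompf's loop `τ·ρ` is essential in `GL⁺(3, ℝ)`.** If it were null-homotopic,
so would be its Gram–Schmidt retraction in `SO(3)`; but the lift of the latter to the universal
cover `S³` starting at `Γ(0)` is `Γ`, which ends at `-Γ(0) ≠ Γ(0)`, while homotopic loops have lifts
with the same end point (monodromy). [cite: GompfAGT2010, Thm 4.3 (proof, last paragraph: the 1-cycle τ·ρ is nontrivial, "nonzero by inspection")] -/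
theorem gompf2010_framingLoop_essential_holds : gompf2010_framingLoop_essential := by
  intro hnull
  -- retract to `SO(3)`
  have hnull' : (gompfFramingLoop.map retr.continuous).Homotopic
      ((Path.refl (slPoint gompfFramingA)).map retr.continuous) := hnull.map retr
  have hrefl : (Path.refl (slPoint gompfFramingA)).map retr.continuous =
      Path.refl (retr (slPoint gompfFramingA)) := by
    ext
    rfl
  rw [hrefl] at hnull'
  -- the loop and the constant loop as continuous maps, and their lifts from `e = Γ 0`
  set γ₀ : C(I, Literature.AlgebraicTopology.FundamentalGroup.SO3) := (gompfFramingLoop.map retr.continuous).toContinuousMap with hγ₀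
  set γ₁ : C(I, Literature.AlgebraicTopology.FundamentalGroup.SO3) := (Path.refl (retr (slPoint gompfFramingA))).toContinuousMap with hγ₁
  set e : Metric.sphere (0 : ℍ) 1 := gompfLoopLift 0 with he
  have hstart : γ₀ 0 = Literature.AlgebraicTopology.FundamentalGroup.rotHom e := by
    rw [he]
    exact (rotHom_gompfLift 0).symm
  have hstart' : γ₁ 0 = Literature.AlgebraicTopology.FundamentalGroup.rotHom e := by
    rw [← hstart]
    show retr (slPoint gompfFramingA) = retr (gompfFramingLoop 0)
    rw [gompfFramingLoop.source]
  have hrel : γ₀.HomotopicRel γ₁ {0, 1} := hnull'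
  have hlift : (gompfLoopLift : C(I, Metric.sphere (0 : ℍ) 1)) = Literature.AlgebraicTopology.FundamentalGroup.isCoveringMap_rotHom.liftPath γ₀ e hstart := by
    rw [Literature.AlgebraicTopology.FundamentalGroup.isCoveringMap_rotHom.eq_liftPath_iff']
    exact ⟨funext fun t ↦ rotHom_gompfLift t, rfl⟩
  have hconst : ContinuousMap.const I e = Literature.AlgebraicTopology.FundamentalGroup.isCoveringMap_rotHom.liftPath γ₁ e hstart' := by
    rw [Literature.AlgebraicTopology.FundamentalGroup.isCoveringMap_rotHom.eq_liftPath_iff']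
    exact ⟨funext fun _ ↦ hstart'.symm, rfl⟩
  have hend := Literature.AlgebraicTopology.FundamentalGroup.isCoveringMap_rotHom.liftPath_apply_one_eq_of_homotopicRel hrel e hstart hstart'
  rw [← hlift, ← hconst] at hend
  -- `Γ 1 = -Γ 0` but the constant lift ends at `Γ 0`
  have h1 : ((gompfLoopLift 1 : Metric.sphere (0 : ℍ) 1) : ℍ) = -(e : ℍ) := by
    rw [gompfLoopLift.target, he, gompfLoopLift.source]
    exact liftSeg5_one
  have h2 : ((gompfLoopLift 1 : Metric.sphere (0 : ℍ) 1) : ℍ) = (e : ℍ) := congrArg Subtype.val hend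
  have hzero : (e : ℍ) = 0 := by
    have hee : (e : ℍ) = -(e : ℍ) := h2.symm.trans h1
    have h2x : (2 : ℝ) • (e : ℍ) = 0 := by
      rw [two_smul]
      nth_rewrite 2 [hee]
      exact add_neg_cancel _
    exact (smul_eq_zero.1 h2x).resolve_left two_ne_zero
  have hnorm := norm_eq_of_mem_sphere e
  rw [hzero, norm_zero] at hnorm
  exact zero_ne_one hnorm

end Essential

end Literature.Topology.FourManifolds

/-! ### Assembly with the classical leaves discharged -/

namespace Literature.Topology.FourManifolds

universe u

/-- Local notation: `𝔼 n` is the model Euclidean space `EuclideanSpace ℝ (Fin n)`. -/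
local notation "𝔼 " n:arg => EuclideanSpace ℝ (Fin n)

variable (X : Type u) [TopologicalSpace X] [T2Space X] [SecondCountableTopology X]
  [ChartedSpace (𝔼 4) X] [IsManifold (𝓡 4) ∞ X] [CompactSpace X]

/-- **The current leaf set (geometric leaves only).**
`nonempty_diffeomorph_sphere_four_of_isCappellShanesonSphereOf X` from the six geometric leaves —
the framings of the section circle (`gompf2010_sectionCircle_framings`, tubular-neighbourhood
uniqueness, at two universes), straightening-class invariance **W**, conjugation invariance **Cj**,
the framed Theorem 2.1 **F**/**F₀**, and [AK1] — the classical leaves `π₁ GL⁺(3, ℝ) = ℤ/2` and the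
essential loop being proved in this file. [cite: GompfAGT2010, Examples 3.1(a)] -/
theorem nonempty_diffeomorph_sphere_four_of_isCappellShanesonSphereOf_of_geometric
    (hS : gompf2010_sectionCircle_framings.{u}) (hS₀ : gompf2010_sectionCircle_framings.{0})
    (hW : gompf2010_straightening_invariance) (hC : gompf2010_conj_invariance)
    (hF : gompf2010_framedTwist) (hF₀ : gompf2010_framedTwistZero)
    (hAK : akbulutKirby1979_linearStraightening) :
    nonempty_diffeomorph_sphere_four_of_isCappellShanesonSphereOf X :=
  nonempty_diffeomorph_sphere_four_of_isCappellShanesonSphereOf_of_atomic X hS hS₀ hW hC hF hF₀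
    fundamentalGroup_posDetMatrix_three_holds gompf2010_framingLoop_essential_holds hAK

end Literature.Topology.FourManifolds
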